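import Summits.HodgeConjecture.HodgeConjecture.Theorems.R90S10SteinbergFactorOfLengthTwoLabels    -- ★ p863145 `steinbergFactorSt_of_sqInt : (St₂-L²) → ‹A1′›`
import Summits.HodgeConjecture.HodgeConjecture.Theorems.R90S10U2SteinbergSquareIntegrable         -- ★-cand brick (C) `st₂_sqInt : (St₂-L²)`
import HarnessLib

/-!
# R90-TF ∕ S10 — SOCKET A1′ `sock_S10_steinbergFactorSt` PAID UNCONDITIONALLY: the local Steinberg factor `ρ₀` of `π_St`
# (`Theorems/R90S10SteinbergFactorSt.lean`; ns `Summit.HodgeConjecture.HodgeConjecture.R90.S10`; lane `--supports stmt-HodgeConjecture-24833 --as helper`)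

Cell `pub/hodgecm-mathlib`, R90-TF SLAB section S10, seat R90-C138-p04 (g0), card A1′, brick (D): the composition of ★ p863145
`steinbergFactorSt_of_sqInt : (St₂-L²) → ‹A1′›` with ★ brick (C) `st₂_sqInt : (St₂-L²)` (itself = brick (A) Casselman «⇐» on `U(Φ₂)(L⁺_v)` ★ p863417 ∘ brick (B) the Jacquet
character `χH₂` of `St(ξ₂)`).  ONE THEOREM, whose type is the statement of `Cruxes/H413/Lines/R90_S10_SimpleTF1383A.lean` :116–:146 `sock_S10_steinbergFactorSt`
TOKEN FOR TOKEN (junction certificate of p863145), now WITHOUT hypotheses: the typist pays A1′ by name, `sock_S10_steinbergFactorSt := steinbergFactorSt`.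
THE MATHEMATICS: [Rogawski1990, §13.8 proof of Prop. 13.8.3 p. 218 (iii) «`ρ_w = ρ₀`», `ρ₀ = St_H(ξ)|_{U(Φ₂)}` admissible and square-integrable; §12.1 pp. 171–172; §12.2 p. 173];
[Casselman1995, Thm. 4.4.6].  HONEST LABEL: helper ★ pays no socket until A ED. 2 names it; HC_CM is proved only modulo the 7 printed citations (2 remaining named inputs:
hLiu418 = `stmt-HodgeConjecture-24832`, h413 = `stmt-HodgeConjecture-24833`) until rung 0 closes; REL ≠ ★ ≠ BUILT; count-neutral.
-/

set_option autoImplicit false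
set_option linter.dupNamespace false

noncomputable section

open scoped RestrictedProduct Matrix MatrixGroups
open Filter MeasureTheory NumberField IsDedekindDomain CompactlySupported Topology
open Literature.NumberTheory.Rogawski1990 Literature.NumberTheory.Automorphic Literature.NumberTheory.Automorphic.UnitaryGroup
open Literature.NumberTheory.Automorphic.UnitaryGroup.CotangentForms Literature.NumberTheory.GaloisRepresentations
open Literature.NumberTheory.Automorphic.Arthur2013.Leaves.TECR
open Summit.HodgeConjecture.HodgeConjecture.Cruxes.H413.K2E1TraceFormulaBeta

namespace Summit.HodgeConjecture.HodgeConjecture.R90.S10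

/-- **SOCKET A1′ — THE LOCAL STEINBERG FACTOR OF `π_St`, UNCONDITIONALLY.**  Under the binder prefix ⟪P⟫ of ★ `E1St1383Letter` there is a class `ρ₀` of `U(Φ₂)(L⁺_v)`,
ADMISSIBLE and SQUARE-INTEGRABLE modulo the centre, with `ρ₀ ⊠ (ψ_v ∘ det) = π_St` as classes — the statement of `sock_S10_steinbergFactorSt` token for token
(★ `steinbergFactorSt_of_sqInt` at ★ `st₂_sqInt`). [cite: Rogawski1990, §13.8 Prop. 13.8.3 (proof) p. 218; §12.1 pp. 171–172; §12.2 p. 173] [cite: Casselman1995, Thm. 4.4.6 p. 45] -/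
theorem steinbergFactorSt :
    ∀ (L : Type) [Field L] [NumberField L] [IsCMField L] (μ : HeckeCharacter L) (ξ : OneDimAutRepH L) (v : Pl L),
      (∀ w : PlacesOver L v, IsCMField.complexConj L • w.1 = w.1) → μ.IsUnitary →
      (∀ x : Literature.NumberTheory.GaloisRepresentations.ideleGroup ↥(maximalRealSubfield L),
        μ (AdeleRing.ideleBaseChange (↥(maximalRealSubfield L)) L x) = quadraticHeckeCharCM L x) →
      ∀ [MeasurableSpace (HLoc L v)] [BorelSpace (HLoc L v)] [MeasurableSpace (Gqs L v)] [BorelSpace (Gqs L v)]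
        (νHv : Measure (HLoc L v)) (νQv : Measure (Gqs L v))
        [νHv.IsHaarMeasure] [νHv.IsMulRightInvariant] [νQv.IsHaarMeasure] [νQv.IsMulRightInvariant],
      letI : ∀ a : HLoc L v, MeasurableSpace (HLoc L v ⧸ Subgroup.centralizer ({a} : Set (HLoc L v))) := fun _ => borel _
      haveI : ∀ a : HLoc L v, BorelSpace (HLoc L v ⧸ Subgroup.centralizer ({a} : Set (HLoc L v))) := fun _ => ⟨rfl⟩
      letI : ∀ γ : Gqs L v, MeasurableSpace (Gqs L v ⧸ Subgroup.centralizer ({γ} : Set (Gqs L v))) := fun _ => borel _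
      haveI : ∀ γ : Gqs L v, BorelSpace (Gqs L v ⧸ Subgroup.centralizer ({γ} : Set (Gqs L v))) := fun _ => ⟨rfl⟩
      ∀ (mHv : OrbitalMeasureFamily (HLoc L v)) (mQv : OrbitalMeasureFamily (Gqs L v)),
        mHv.IsCanonical (IsLocalGRegular L v) νHv →
        mQv.IsCanonical (fun γ => IsRegularElt (γ.val : GL (Fin 3) (UnitaryGroup.LocalRing L v))) νQv →
        ∀ (π₁ πSt : IrrClass (HLoc L v)),
          HLengthTwoLabels L v
            (torusCharPair (conjLocal L (IsCMField.complexConj L) v) (cmLocalForm L 2 v) (cmLocalForm_eq_over L 2 v) 0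
              ((torusLocalComponent L (IsCMField.complexConj L) v ξ.η).comp
                  (quotConj (conjLocal L (IsCMField.complexConj L) v) (conjLocal_conjLocal_cm L v)) *
                halfModulusChar (UnitaryGroup.LocalRing L v))
              (torusLocalComponent L (IsCMField.complexConj L) v ξ.ψ))
            ((torusLocalComponent L (IsCMField.complexConj L) v ξ.ψ).comp (localDet (IsCMField.complexConj L) v (isUnit_antidiagOne_det L 1))) π₁ πSt →
          (∀ fH : HLoc L v → ℂ, IsLocSmooth fH → π₁.smoothTrace νHv fH = charDist (ξ.xiLocalChar v) νHv fH) →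
          ∃ (ρ₀ : IrrClass ((UnitaryGroup.cmDatum L 2 (Matrix.of fun i j : Fin 2 => if i.val + j.val + 1 = 2 then (1 : L) else 0)).Local v))
            (hχ : IsOpen ((((torusLocalComponent L (IsCMField.complexConj L) v ξ.ψ).comp (localDet (IsCMField.complexConj L) v (isUnit_antidiagOne_det L 1))).ker : Subgroup ↥(UnitaryGroup.«local» L (IsCMField.complexConj L) 1 (Matrix.of fun i j : Fin 1 => if i.val + j.val + 1 = 1 then (1 : L) else 0) v)) : Set ↥(UnitaryGroup.«local» L (IsCMField.complexConj L) 1 (Matrix.of fun i j : Fin 1 => if i.val + j.val + 1 = 1 then (1 : L) else 0) v))),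
            ρ₀.IsAdmissible ∧
            (letI : MeasurableSpace ((UnitaryGroup.cmDatum L 2 (Matrix.of fun i j : Fin 2 => if i.val + j.val + 1 = 2 then (1 : L) else 0)).Local v ⧸ Subgroup.center ((UnitaryGroup.cmDatum L 2 (Matrix.of fun i j : Fin 2 => if i.val + j.val + 1 = 2 then (1 : L) else 0)).Local v)) := borel _
             ∃ μZ : Measure ((UnitaryGroup.cmDatum L 2 (Matrix.of fun i j : Fin 2 => if i.val + j.val + 1 = 2 then (1 : L) else 0)).Local v ⧸ Subgroup.center ((UnitaryGroup.cmDatum L 2 (Matrix.of fun i j : Fin 2 => if i.val + j.val + 1 = 2 then (1 : L) else 0)).Local v)), μZ.IsHaarMeasure ∧ ρ₀.IsSquareIntegrable μZ) ∧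
            IrrClass.boxChar ((torusLocalComponent L (IsCMField.complexConj L) v ξ.ψ).comp (localDet (IsCMField.complexConj L) v (isUnit_antidiagOne_det L 1))) hχ ρ₀ = πSt :=
  steinbergFactorSt_of_sqInt st₂_sqInt

end Summit.HodgeConjecture.HodgeConjecture.R90.S10

end
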